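import Mathlib
import Summits.Ventures.PercRepro.TriangleCapThirdOrderTwelve
import Summits.Ventures.PercRepro.TriangleCapBelowGen

/-!
# PercRepro — THE THIRD ORDER ON THE DIAGONAL CELL `(13, 4, 0)` IS AT LEAST `34`: a `K₄⁻`-free graph with `36`
edges on `13` vertices is `4`-bipartite, or `5`-bipartite, or at least `34` below `m k` (p3, gen 46; part 199u)

At `k = 13 = 3a + 1` (`a = 4`) the corrected third-order reading of §10bz(e) predicts `B3 = (2k − 4a − 4)(4a + 3 − k)
= 36` (the hung family needs `k = 3a`); here the bound `34`, the corner piece of the row `a = 5` at `r = 4`. The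
vertex types of part 199f one up: the cap `9` makes `D` `4`-bipartite (`diag_cap_gen`); degrees in `[5, 8]` give
`k (k − 9) = 52`; a vertex `z` of degree `d ≤ 4` is deleted onto `12` vertices: `d = 0` is `K_{6,6}` plus an isolated
vertex (`432 ≤ 434`); `d = 1`: `(12, 5, 0)` — `K_{5,7}` (the neighbour on the `5`-side: `D` `5`-bipartite; off it:
`6`-bipartite with `6` missing pairs, `≤ 432`) or `≤ 410` with `T ≤ 7`; `d = 2`: `(12, 5, 1)`; `d = 3`: `(12, 5, 2)`
(`below_second_order_gen`); `d = 4`: `(12, 32)` at third order — `K_{4,8}` (the four neighbours on one side: `D`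
`4`- or `5`-bipartite), `5`-bipartite (the side lemma, `T ≤ 26`: `432`), or `≤ 358` with `T ≤ 28`:
`358 + 56 + 20 = 434 = m k − 34` exactly. Axioms: standard.
-/

namespace PercRepro

namespace TriangleCap

namespace C047

open Finset

variable {V : Type*} [Fintype V] [DecidableEq V]

/-- **THE THIRD ORDER ON `(13, 36)` IS AT LEAST `34`:** `K₄⁻`-free, `k = 13`, `m = 36` ⇒ `D` is a spanning subgraph
of some `K(A, Aᶜ)` with `|A| = 4`, or of one with `|A| = 5`, or `Σ_v d(v)² + 34 ≤ m k`. -/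
theorem four_diag_third_order_thirteen (D : SimpleGraph V) [DecidableRel D.Adj] (hK : K4mFree D)
    (hk : Fintype.card V = 13) (hm : D.edgeFinset.card = 36) :
    (∃ A : Finset V, A.card = 4 ∧ BipSub D A) ∨ (∃ A : Finset V, A.card = 5 ∧ BipSub D A) ∨
      ∑ v, deg D v * deg D v + 34 ≤ D.edgeFinset.card * Fintype.card V := by
  -- (A) a vertex at the cap `9` makes `D` `4`-bipartite
  by_cases hx : ∃ x, deg D x + 4 = Fintype.card V
  · obtain ⟨x, hx⟩ := hx
    exact Or.inl (diag_cap_gen D hK 4 (le_refl 4) (by omega) (by rw [hk, hm]) x hx)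
  push Not at hx
  have hcap : ∀ v, deg D v + 4 ≤ Fintype.card V := fun v =>
    deg_add_le_card_of_dense D hK 4 (by norm_num) (by omega)
      (cap_arith 4 (Fintype.card V) D.edgeFinset.card 0 (by norm_num) (by omega) (by omega)) v
  have hcap' : ∀ v, deg D v + 4 + 1 ≤ Fintype.card V := fun v => by
    have h1 := hcap v
    have h2 := hx v
    omega
  have hcap8 : ∀ v, deg D v ≤ 7 + 1 := fun v => by have := hcap' v; omega
  -- (B) every degree `≥ 5`: the convexity of the row `5` gives `52`
  by_cases hdeg : ∀ v, 4 + 1 ≤ deg D v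
  · right; right
    have h := diag_convex_gen D 4 (by omega) (by rw [hk, hm]) hcap' hdeg
    rw [hk, hm] at h ⊢
    omega
  push Not at hdeg
  obtain ⟨z, hz⟩ := hdeg
  -- the deletion bookkeeping
  have hK' := k4mFree_del D hK z
  have hcard' := card_del z
  have hedges' := card_edges_del D z
  have hsq := sum_deg_sq_del D z
  have hT := sum_del_nbhd_le D z 7 hcap8
  have hNz := card_nbhd_del D z
  obtain ⟨T, hTdef⟩ : ∃ T, ∑ a : {v : V // v ≠ z}, (if D.Adj a.1 z then deg (del D z) a else 0) = T := ⟨_, rfl⟩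
  obtain ⟨S', hS'def⟩ : ∃ S', ∑ a : {v : V // v ≠ z}, deg (del D z) a * deg (del D z) a = S' := ⟨_, rfl⟩
  obtain ⟨m', hm'def⟩ : ∃ m', (del D z).edgeFinset.card = m' := ⟨_, rfl⟩
  obtain ⟨Nz, hNzdef⟩ : ∃ Nz : Finset {v : V // v ≠ z},
      Nz = univ.filter (fun a : {v : V // v ≠ z} => D.Adj a.1 z) := ⟨_, rfl⟩
  have hmemNz : ∀ a : {v : V // v ≠ z}, a ∈ Nz ↔ D.Adj a.1 z := fun a => by
    rw [hNzdef, mem_filter]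
    simp only [mem_univ, true_and]
  have hTfilt : T = ∑ a ∈ Nz, deg (del D z) a := by
    rw [← hTdef, hNzdef, sum_filter]
  rw [← hNzdef] at hNz
  rw [hTdef, hS'def] at hsq
  rw [hTdef] at hT
  rw [hm'def] at hedges'
  have hcardW' : Fintype.card {v : V // v ≠ z} = 12 := by omega
  have hdegNz : ∀ a ∈ Nz, deg (del D z) a ≤ 7 := fun a ha => by
    have h := deg_del D z a
    rw [if_pos ((hmemNz a).mp ha)] at h
    have := hcap8 a.1
    omega
  -- the side lemma for a `D − z` that is a spanning subgraph of `K(A', A'ᶜ)` with `|A'| = 5`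
  have hside : ∀ A' : Finset {v : V // v ≠ z}, A'.card = 5 → BipSub (del D z) A' →
      (∃ A : Finset V, A.card = 5 ∧ BipSub D A) ∨
        (∑ v, deg D v * deg D v + 34 ≤ D.edgeFinset.card * Fintype.card V) ∨
        (T + 7 ≤ deg D z * 7 + 5) := by
    intro A' hA'card hB
    by_cases hall : ∀ a : {v : V // v ≠ z}, D.Adj a.1 z → a ∈ A'
    · obtain ⟨B, hBcard, hBsub⟩ := bipSub_lift D z A' hB hall
      exact Or.inl ⟨B, by rw [hBcard, hA'card], hBsub⟩
    by_cases hnone : ∀ a : {v : V // v ≠ z}, D.Adj a.1 z → a ∉ A'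
    · right; left
      obtain ⟨A, hAcard, hAsub⟩ := bipSub_insert_of_nbhd_off D z A' hB hnone
      rw [hA'card] at hAcard
      have h := sum_deg_sq_le_of_bipSub D A hAsub 6 6 hAcard (by rw [hk, hm]) (by omega)
      rw [hk, hm] at h ⊢
      omega
    · right; right
      push Not at hall
      obtain ⟨w₀, hw₀z, hw₀A⟩ := hall
      have hdw₀ : deg (del D z) w₀ ≤ 5 := by
        have := deg_le_card_of_bipSub (del D z) A' hB w₀ hw₀A
        rw [hA'card] at this
        exact this
      rw [hTfilt, ← hNz]
      exact sum_le_of_mem_le_gen Nz (fun a => deg (del D z) a) 7 5 ((hmemNz w₀).mpr hw₀z) hdegNz hdw₀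
  have hd : deg D z = 0 ∨ deg D z = 1 ∨ deg D z = 2 ∨ deg D z = 3 ∨ deg D z = 4 := by omega
  rcases hd with hd0 | hd1 | hd2 | hd3 | hd4
  · -- `d = 0`: `36` edges on `12` vertices, the envelope
    right; right
    have henv := sum_deg_sq_le_of_k4mFree (del D z) hK' (by omega)
    rw [hS'def, hm'def, hcardW'] at henv
    rw [hd0] at hT
    rw [hsq, hk, hm, hd0]
    omega
  · -- `d = 1`: `D − z` on the diagonal `(12, 5, 0)`
    have hm'35 : m' = 35 := by omega
    rcases diag_second_order_gen (del D z) hK' 5 (by norm_num) (by omega) (by rw [hm'def, hcardW', hm'35])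
      with ⟨A', hA'card, hB⟩ | hgap
    · rcases hside A' hA'card hB with h | h | hT'
      · exact Or.inr (Or.inl h)
      · exact Or.inr (Or.inr h)
      · right; right
        have henv := sum_deg_sq_le_of_k4mFree (del D z) hK' (by omega)
        rw [hS'def, hm'def, hcardW', hm'35] at henv
        rw [hd1] at hT'
        rw [hsq, hk, hm, hd1]
        omega
    · right; right
      rw [hS'def, hm'def, hcardW', hm'35] at hgap
      rw [hd1] at hT
      rw [hsq, hk, hm, hd1]
      omega
  · -- `d = 2`: `D − z` on `(12, 5, 1)`
    have hm'34 : m' = 34 := by omega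
    rcases one_below_second_order_gen (del D z) hK' 5 (by norm_num) (by omega)
      (by rw [hm'def, hcardW', hm'34]) with ⟨A', hA'card, hB⟩ | hgap
    · rcases hside A' hA'card hB with h | h | hT'
      · exact Or.inr (Or.inl h)
      · exact Or.inr (Or.inr h)
      · right; right
        have hS := sum_deg_sq_le_of_bipSub (del D z) A' hB 5 1 hA'card (by rw [hm'def, hcardW', hm'34])
          (by omega)
        rw [hS'def, hm'def, hcardW', hm'34] at hS
        rw [hd2] at hT'
        rw [hsq, hk, hm, hd2]
        omega
    · right; right
      rw [hS'def, hm'def, hcardW', hm'34] at hgap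
      rw [hd2] at hT
      rw [hsq, hk, hm, hd2]
      omega
  · -- `d = 3`: `D − z` on `(12, 5, 2)`
    have hm'33 : m' = 33 := by omega
    rcases below_second_order_gen (del D z) hK' 5 2 (by norm_num) (by norm_num) (by norm_num) (by omega)
      (by rw [hm'def, hcardW', hm'33]) with ⟨A', hA'card, hB⟩ | hgap
    · rcases hside A' hA'card hB with h | h | hT'
      · exact Or.inr (Or.inl h)
      · exact Or.inr (Or.inr h)
      · right; right
        have hS := sum_deg_sq_le_of_bipSub (del D z) A' hB 5 2 hA'card (by rw [hm'def, hcardW', hm'33])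
          (by omega)
        rw [hS'def, hm'def, hcardW', hm'33] at hS
        rw [hd3] at hT'
        rw [hsq, hk, hm, hd3]
        omega
    · right; right
      rw [hS'def, hm'def, hcardW', hm'33] at hgap
      rw [hd3] at hT
      rw [hsq, hk, hm, hd3]
      omega
  · -- `d = 4`: `D − z` on the diagonal `(12, 32)` at third order
    have hm'32 : m' = 32 := by omega
    rw [hd4] at hT hNz
    rcases four_diag_third_order_twelve (del D z) hK' hcardW' (by rw [hm'def, hm'32])
      with ⟨A', hA'card, hA'⟩ | ⟨A', hA'card, hB⟩ | hthird
    · -- `D − z = K_{4,8}`: the four neighbours of `z` lie on one side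
      have hfull : ∀ {x y : {v : V // v ≠ z}}, x ∈ A' → y ∉ A' → (del D z).Adj x y := fun hx hy =>
        adj_of_bipSub_full (del D z) A' hA' 4 hA'card (by rw [hm'def, hcardW', hm'32]) hx hy
      by_cases hall : ∀ a : {v : V // v ≠ z}, D.Adj a.1 z → a ∈ A'
      · obtain ⟨B, hBcard, hB⟩ := bipSub_lift D z A' hA' hall
        exact Or.inl ⟨B, by rw [hBcard, hA'card], hB⟩
      · push Not at hall
        obtain ⟨a₀, ha₀z, ha₀A⟩ := hall
        have hoff : ∀ a : {v : V // v ≠ z}, D.Adj a.1 z → a ∉ A' := by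
          intro a₁ ha₁z ha₁A
          have hne01 : a₀ ≠ a₁ := fun h => ha₀A (h ▸ ha₁A)
          obtain ⟨a₂, ha₂z, ha₂0, ha₂1⟩ : ∃ a₂ : {v : V // v ≠ z}, D.Adj a₂.1 z ∧ a₂ ≠ a₀ ∧ a₂ ≠ a₁ := by
            have h2 : 2 < Nz.card := by omega
            obtain ⟨b₁, hb₁, b₂, hb₂, b₃, hb₃, h12, h13, h23⟩ := two_lt_card.mp h2
            rw [hmemNz] at hb₁ hb₂ hb₃
            by_cases e1 : b₁ = a₀ ∨ b₁ = a₁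
            · by_cases e2 : b₂ = a₀ ∨ b₂ = a₁
              · refine ⟨b₃, hb₃, ?_, ?_⟩
                · intro h; rcases e1 with rfl | rfl <;> rcases e2 with rfl | rfl <;>
                    first | exact h12 rfl | exact h13 h | exact h13 h.symm | exact h23 h | exact h23 h.symm
                · intro h; rcases e1 with rfl | rfl <;> rcases e2 with rfl | rfl <;>
                    first | exact h12 rfl | exact h13 h | exact h13 h.symm | exact h23 h | exact h23 h.symm
              · push Not at e2
                exact ⟨b₂, hb₂, e2.1, e2.2⟩
            · push Not at e1
              exact ⟨b₁, hb₁, e1.1, e1.2⟩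
          have h10 : D.Adj a₁.1 a₀.1 := (del_adj D z a₁ a₀).mp (hfull ha₁A ha₀A)
          by_cases ha₂A : a₂ ∈ A'
          · have h20 : D.Adj a₂.1 a₀.1 := (del_adj D z a₂ a₀).mp (hfull ha₂A ha₀A)
            exact not_adj_both D hK (D.adj_symm ha₀z) (D.adj_symm ha₁z) (D.adj_symm h10)
              (fun h => ha₂1 (Subtype.ext h).symm) (D.adj_symm ha₂z) (D.adj_symm h20)
          · have h12' : D.Adj a₁.1 a₂.1 := (del_adj D z a₁ a₂).mp (hfull ha₁A ha₂A)
            exact not_adj_both D hK (D.adj_symm ha₁z) (D.adj_symm ha₀z) h10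
              (fun h => ha₂0 (Subtype.ext h).symm) (D.adj_symm ha₂z) h12'
        obtain ⟨B, hBcard, hB⟩ := bipSub_insert_of_nbhd_off D z A' hA' hoff
        exact Or.inr (Or.inl ⟨B, by rw [hBcard, hA'card], hB⟩)
    · -- `D − z` is `5`-bipartite on `(12, 5, 3)`
      rcases hside A' hA'card hB with h | h | hT'
      · exact Or.inr (Or.inl h)
      · exact Or.inr (Or.inr h)
      · right; right
        have hS := sum_deg_sq_le_of_bipSub (del D z) A' hB 5 3 hA'card (by rw [hm'def, hcardW', hm'32])
          (by omega)
        rw [hS'def, hm'def, hcardW', hm'32] at hS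
        rw [hsq, hk, hm, hd4]
        omega
    · -- neither: at most `358`, `T ≤ 28`
      right; right
      rw [hS'def, hm'def, hcardW', hm'32] at hthird
      rw [hsq, hk, hm, hd4]
      omega

end C047

end TriangleCap

end PercRepro
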